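import Literature.MathematicalPhysics.QuantumFieldTheory.Balaban1983to89.B9Delta2FormMajorant
import Literature.MathematicalPhysics.QuantumFieldTheory.Balaban1983to89.Node00.OpsYDelta2FormQ

/-!
# `Balaban1983to89.B9Delta2FormMajorantH` — T. Bałaban, *Propagators for lattice gauge theories in a background field*, Commun. Math. Phys. **99** (1985) 389–434
# [Balaban1985BackgroundPropagators], (3.136)–(3.137) pp. 422–423: THE SUP MAJORANT OF THE RESIDUAL LETTER `Δ⁽²⁾(U)` OF (3.134) OVER A GENERIC `H` —
# the three `HDY`-keyed theorems of `B9Delta2FormMajorant` §1–§2 re-pressed at node00-def-Y's `delta2OfHY 𝔡 i H C` (so that print's KNIT `H[𝔮]` of (3.126)∕(3.115)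
# — def-Y's `delta2OfQY = delta2OfHY (HDQY 𝔮 𝔮⋆ parS G′)` — is an instance)

statement-level skeleton of published theorems with citation tags; proofs where landed; nothing here is a claim about the Yang–Mills mass gap

THE PRINT.  p. 422 (3.134) *«⟨A, Δ⁽²⁾A⟩ = 2⟨HC⁽²⁾(A), J⟩»*, (3.136) *«Δ⁽²⁾A = Σ … tr (δ∕δA) C_j⁽²⁾(A, b)(H\*J)(b)»*, (3.137) *«|(Δ⁽²⁾A)(b)| ≦ O(1)Mα₀(Lʲη)⁻²|A|»*; the `H` of
(3.134) is the `H` of (3.126) `H = G̃Q\*(QG̃Q\*)⁻¹` FOR PRINT's OWN `Q` — in Sect. D the composite (knit) averaging of (3.115) p. 418.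

WHY THIS FILE (cell `pub-ymgap`, node N06, seat `dag-n06-l` = bundle F7 rows 20–21, gen 38; road «P-D2-knit»).  `B9Delta2FormMajorant` (this seat, g33) proves the
(3.137)-shaped block majorant `hasMajorant_coordOpK_delta2OfY` of def-Y's `delta2OfY 𝔡 i parS parB Gp C` — the residual built from the STRAIGHT pair's `H = HDY parS parB Gp`.
node00-def-Y's `OpsYDelta2FormQ` (W5) rebuilt the residual over a GENERIC `H` (`delta2OfHY`, with (3.136) `trPairY_delta2OfHY_trAdj`) and at print's knit pair
(`delta2OfQY`, `resYOfRecordPK`).  THIS FILE is the `H`-generic edition of the three `HDY`-keyed theorems, proofs copied with `HDY i parS parB Gp U ↦ H U` and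
`trPairY_delta2OfY_trAdj ↦ trPairY_delta2OfHY_trAdj` — nothing of mathematics added; the letter `C2FormMaj`, `exp_three_point_le` and the slice kit are the parent's
BY NAME.
* §1 ★ `τ_mul_delta2OfHY_apply` — (3.136) read at one fine bond over a generic `H`.
* §2 ★ `abs_repr_delta2OfHY_apply_le` — the trace coordinates of `(Δ⁽²⁾(U)A)(z)` from the two letters; ★★ `hasMajorant_coordOpK_delta2OfHY` — the [4]-(2.51) block
  majorant `r·(2N·b²·κ_C·t·C_T·c_R)·W(y)·e^{−δ₂d(y,y′)}` of `r • coordOpK (delta2OfHY … H C U)` from `C2FormMaj`, the current letter `‖(H(U)†J(U))(c)‖ ≦ t·w_H(c)`,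
  the p. 398 transfer and a row sum.
HONEST SCOPE.  Finite-dimensional bookkeeping re-instantiated; the two letters of (3.136) are HYPOTHESES; nothing of [B9] or [5] asserted; count-neutral; N06 NOT discharged;
nothing continuum ∕ OS ∕ mass gap ∕ Clay.  NEW file; `B9Delta2FormMajorant` and `Node00.OpsYDelta2FormQ` untouched and used BY NAME.
-/

noncomputable section

namespace Literature.MathematicalPhysics.QuantumFieldTheory.Balaban1983to89.B9Delta2FormMajorantH

open Node00 (TrDualY trDualMatY trDualMatY_τ trPairY trPairY_def trAdjY delta2OfHY trPairY_delta2OfHY_trAdj JY SiteParY BondParY SiteOpY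
  CfgY FBondY IBondY BondOpY deltaY)
open B6KLevelCensusIndexV1 (KIdx)
open B9CoReadingCoordsTranspose (TrIdx trBasis trBasis_repr_eq_trace)
open B9CoReadingCoords (XBK assembleK coordOpK coordOpK_apply)
open B9Thm39ReadingCoords (basisBound39)
open B9SiteKernelBlockMajorant (norm_assembleK_le assembleK_eq_zero_of)
open B6RandomWalk (HasMajorant BlockSupp)
open B9Thm34Ext (toB6)
open B9Thm312Whole (GeoOK)
open B9Delta2FormMajorant (trPairY_deltaY_left C2FormMaj exp_three_point_le)
open scoped Matrix
open scoped Matrix.Norms.L2Operator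

/-! ## §0 Trace against the operator norm on `M_N(ℂ)` -/

section Trace

variable {N : ℕ}

/-- an entry is bounded by the L²-operator norm (test against a basis vector). [folklore] -/
private theorem norm_apply_le_norm (A : Matrix (Fin N) (Fin N) ℂ) (a a' : Fin N) : ‖A a a'‖ ≤ ‖A‖ := by
  have h := Matrix.l2_opNorm_mulVec A (EuclideanSpace.single a' (1 : ℂ))
  have h1 : ‖(EuclideanSpace.single a' (1 : ℂ))‖ = 1 := by simp
  rw [h1, mul_one] at h
  refine le_trans ?_ h
  refine le_trans (le_of_eq ?_) (PiLp.norm_apply_le _ a)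
  simp

/-- `|Re tr M| ≤ N·‖M‖` for the L²-operator norm. [folklore] -/
private theorem abs_re_trace_le (M : Matrix (Fin N) (Fin N) ℂ) : |(Matrix.trace M).re| ≤ N * ‖M‖ := by
  rw [Matrix.trace, Complex.re_sum]
  calc |∑ a, (M.diag a).re| ≤ ∑ a, |(M.diag a).re| := Finset.abs_sum_le_sum_abs _ _
    _ ≤ ∑ a : Fin N, ‖M‖ := Finset.sum_le_sum fun a _ => (Complex.abs_re_le_norm _).trans (norm_apply_le_norm M a a)
    _ = N * ‖M‖ := by simp

/-- `|Re tr(XY)| ≤ N·‖X‖·‖Y‖`. [folklore] -/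
private theorem abs_re_trace_mul_le (X Y : Matrix (Fin N) (Fin N) ℂ) : |(Matrix.trace (X * Y)).re| ≤ N * ‖X‖ * ‖Y‖ := by
  calc |(Matrix.trace (X * Y)).re| ≤ N * ‖X * Y‖ := abs_re_trace_le _
    _ ≤ N * (‖X‖ * ‖Y‖) := mul_le_mul_of_nonneg_left (norm_mul_le X Y) (Nat.cast_nonneg N)
    _ = N * ‖X‖ * ‖Y‖ := by ring

end Trace

/-! ## §1 (3.136) read at one fine bond, generic `H` -/

section Reading

variable {d ℓ : ℕ} {hd : 1 ≤ d + 1} {hL : Odd (ℓ + 1) ∧ 1 < ℓ + 1} {b₀ b₁ : ℝ}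
variable {𝔸 : Type} [NormedRing 𝔸] [NormedAlgebra ℂ 𝔸] [CompleteSpace 𝔸]
variable (𝔡 : TrDualY 𝔸) (i : KIdx d ℓ hd hL b₀ b₁) (H : CfgY 𝔸 i → ((IBondY i → 𝔸) →ₗ[ℂ] (FBondY i → 𝔸)))
variable (C : CfgY 𝔸 i → (FBondY i → 𝔸) →ₗ[ℂ] (FBondY i → 𝔸) →ₗ[ℂ] (IBondY i → 𝔸))

/-- ★ **(3.136) READ AT ONE FINE BOND**: `τ(a·(Δ⁽²⁾(U)A)(z)) = 2⟨C⁽²⁾(U; A, δ_z ⊗ a), H(U)†J(U)⟩_τ` — print's *"Δ⁽²⁾A = Σ_j Σ_{b∈Λ_j} (Lʲη)^{d+1}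
tr (δ∕δA) C_j⁽²⁾(A, b)(H\*J)(b)"* in def-Y's normalisation (`trPairY_delta2OfY_trAdj` at the test function `δ_z ⊗ a`).
[cite: Balaban1985BackgroundPropagators, (3.136) p.422, (3.134) p.422] -/
theorem τ_mul_delta2OfHY_apply (U : CfgY 𝔸 i) (A : FBondY i → 𝔸) (z : FBondY i) (a : 𝔸) :
    𝔡.τ (a * delta2OfHY 𝔡 i H C U A z) =
      2 * trPairY 𝔡.τ (C U A (deltaY z a)) (trAdjY 𝔡 (H U) (JY i U)) := by
  rw [← trPairY_deltaY_left 𝔡.τ z a, trPairY_delta2OfHY_trAdj]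

end Reading

/-! ## §2 At the fibre of record `M_N(ℂ)`: the coordinates and the norm of `(Δ⁽²⁾(U)A)(z)` from bounds on the two letters of (3.136) -/

section Fibre

variable {N : ℕ} {d ℓ : ℕ} {hd : 1 ≤ d + 1} {hL : Odd (ℓ + 1) ∧ 1 < ℓ + 1} {b₀ b₁ : ℝ}
variable (i : KIdx d ℓ hd hL b₀ b₁) (H : CfgY (Matrix (Fin N) (Fin N) ℂ) i → ((IBondY i → Matrix (Fin N) (Fin N) ℂ) →ₗ[ℂ] (FBondY i → Matrix (Fin N) (Fin N) ℂ)))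
  (C : CfgY (Matrix (Fin N) (Fin N) ℂ) i → (FBondY i → Matrix (Fin N) (Fin N) ℂ) →ₗ[ℂ] (FBondY i → Matrix (Fin N) (Fin N) ℂ) →ₗ[ℂ]
    (IBondY i → Matrix (Fin N) (Fin N) ℂ))

/-- ★ **THE COORDINATES OF `(Δ⁽²⁾(U)A)(z)` FROM THE TWO LETTERS OF (3.136)**: if the polarised form at the test deltas is bounded by `K_C(c)·‖a‖` and
`‖(H†J)(c)‖ ≤ h(c)`, then every real trace coordinate of `(Δ⁽²⁾(U)A)(z)` is `≤ 2N·‖E_k‖·Σ_c K_C(c)h(c)` (trace against operator norm, term by term).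
[cite: Balaban1985BackgroundPropagators, (3.136)–(3.137) pp.422–423] -/
theorem abs_repr_delta2OfHY_apply_le (U : CfgY (Matrix (Fin N) (Fin N) ℂ) i) (A : FBondY i → Matrix (Fin N) (Fin N) ℂ) (z : FBondY i)
    {KC h : IBondY i → ℝ} (hKC : ∀ c, 0 ≤ KC c)
    (hC : ∀ (a : Matrix (Fin N) (Fin N) ℂ) (c : IBondY i), ‖C U A (deltaY z a) c‖ ≤ KC c * ‖a‖)
    (hHJ : ∀ c : IBondY i, ‖trAdjY (trDualMatY N) (H U) (JY i U) c‖ ≤ h c) (k : TrIdx N) :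
    |(trBasis N).repr (delta2OfHY (trDualMatY N) i H C U A z) k| ≤ 2 * N * ‖trBasis N k‖ * ∑ c, KC c * h c := by
  rw [trBasis_repr_eq_trace]
  have hτ : Matrix.trace ((trBasis N k)ᴴ * delta2OfHY (trDualMatY N) i H C U A z) =
      2 * trPairY (trDualMatY N).τ (C U A (deltaY z (trBasis N k)ᴴ)) (trAdjY (trDualMatY N) (H U) (JY i U)) := by
    rw [← trDualMatY_τ]; exact τ_mul_delta2OfHY_apply (trDualMatY N) i H C U A z _
  rw [hτ, trPairY_def]
  simp only [trDualMatY_τ]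
  set X : IBondY i → Matrix (Fin N) (Fin N) ℂ := C U A (deltaY z (trBasis N k)ᴴ) with hX
  set Y : IBondY i → Matrix (Fin N) (Fin N) ℂ := trAdjY (trDualMatY N) (H U) (JY i U) with hY
  have h2 : ((2 : ℂ) * ∑ x, Matrix.trace (X x * Y x)).re = 2 * ∑ x, (Matrix.trace (X x * Y x)).re := by
    rw [show (2 : ℂ) = ((2 : ℝ) : ℂ) by norm_num, Complex.re_ofReal_mul, Complex.re_sum]
  rw [h2, abs_mul, abs_two]
  have hN : (0 : ℝ) ≤ N := Nat.cast_nonneg N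
  have hterm : ∀ x, |(Matrix.trace (X x * Y x)).re| ≤ N * (KC x * ‖(trBasis N k)ᴴ‖) * h x := fun x =>
    (abs_re_trace_mul_le _ _).trans
      (mul_le_mul (mul_le_mul_of_nonneg_left (hC _ x) hN) (hHJ x) (norm_nonneg _)
        (mul_nonneg hN (mul_nonneg (hKC x) (norm_nonneg _))))
  calc 2 * |∑ x, (Matrix.trace (X x * Y x)).re| ≤ 2 * ∑ x, |(Matrix.trace (X x * Y x)).re| :=
        mul_le_mul_of_nonneg_left (Finset.abs_sum_le_sum_abs _ _) two_pos.le
    _ ≤ 2 * ∑ x, N * (KC x * ‖(trBasis N k)ᴴ‖) * h x := mul_le_mul_of_nonneg_left (Finset.sum_le_sum fun x _ => hterm x) two_pos.le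
    _ = 2 * N * ‖trBasis N k‖ * ∑ c, KC c * h c := by
        rw [Matrix.l2_opNorm_conjTranspose, Finset.mul_sum, Finset.mul_sum]
        exact Finset.sum_congr rfl fun x _ => by ring

end Fibre

/-! ## §3 The [4]-(2.51) block majorant of `Δ⁽²⁾(U)`'s coordinate model over a generic `H` -/

section Majorant

open B9Thm312Whole (GeoOK)
open B9CoReadingCoords (XBK)

variable {N : ℕ} {d ℓ : ℕ} {hd : 1 ≤ d + 1} {hL : Odd (ℓ + 1) ∧ 1 < ℓ + 1} {b₀ b₁ : ℝ}
variable (i : KIdx d ℓ hd hL b₀ b₁) (H : CfgY (Matrix (Fin N) (Fin N) ℂ) i → ((IBondY i → Matrix (Fin N) (Fin N) ℂ) →ₗ[ℂ] (FBondY i → Matrix (Fin N) (Fin N) ℂ)))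
  (C : CfgY (Matrix (Fin N) (Fin N) ℂ) i → (FBondY i → Matrix (Fin N) (Fin N) ℂ) →ₗ[ℂ] (FBondY i → Matrix (Fin N) (Fin N) ℂ) →ₗ[ℂ]
    (IBondY i → Matrix (Fin N) (Fin N) ℂ))
variable {g : B9.Geometry} [Fintype g.Site] {R₀ : ℝ} {H₀ : Prop}

/-- ★★ **THE [4]-(2.51) BLOCK MAJORANT OF `Δ⁽²⁾(U)`'s COORDINATE MODEL — (3.137)'s SHAPE — FROM THE TWO LETTERS OF (3.136)**: under the form letter
`C2FormMaj` (weight `w_C`, rate `δ_C`), print's current letter `‖(H†J)(c)‖ ≦ t·w_H(c)` (p. 422: *"From the regularity condition (3.36) and the inequality (3.133) we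
have the estimate |(H\*J)(b)| ≦ O(1)Mα₀(Lʲη)⁻³"*), the p. 398 scale transfer of the product weight `w_C·w_H ↦ W` at the rate `ρ_T` and a row sum over the coarse
bonds at the rate `ρ_R` (`δ₂ + ρ_T + ρ_R ≦ δ_C`), the scaled model `r • coordOpK` of `Δ⁽²⁾(U)` over the trace basis has the block majorant
`r·(2N·b²·κ_C·t·C_T·c_R)·W(y)·e^{−δ₂d(y,y′)}` w.r.t. the fine block map — print's *"|(Δ⁽²⁾A)(b)| ≦ O(1)Mα₀(Lʲη)⁻²|A|, b ∈ Δ(y)"* with every constant explicit.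
[cite: Balaban1985BackgroundPropagators, (3.136)–(3.137) pp.422–423, p.398 remark after (3.47); Balaban1985Averaging, (149) p.40; Balaban1984PropagatorsII, (2.51) p.232, (2.54), (2.61) pp.233–234] -/
theorem hasMajorant_coordOpK_delta2OfHY (hG : GeoOK g) (σ : FBondY i → g.Site) (σI : IBondY i → g.Site)
    (U : CfgY (Matrix (Fin N) (Fin N) ℂ) i) {κC δC tHJ ρT CT ρR cR δ₂ r : ℝ} {wC wH W : g.Site → ℝ}
    (hκC : 0 ≤ κC) (hwC : ∀ y, 0 ≤ wC y) (htHJ : 0 ≤ tHJ) (hwH : ∀ y, 0 ≤ wH y) (hCT : 0 ≤ CT) (hW : ∀ y, 0 ≤ W y) (hr : 0 ≤ r)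
    (hδ₂ : 0 ≤ δ₂) (hρT : 0 ≤ ρT) (hρR : 0 ≤ ρR) (hδC : δ₂ + ρT + ρR ≤ δC)
    (hC2 : C2FormMaj i σ σI C U κC δC wC)
    (hHJ : ∀ c : IBondY i, ‖trAdjY (trDualMatY N) (H U) (JY i U) c‖ ≤ tHJ * wH (σI c))
    (hT : ∀ (y : g.Site) (c : IBondY i), Real.exp (-(ρT * g.dist y (σI c))) * (wC (σI c) * wH (σI c)) ≤ CT * W y)
    (hR : ∀ y : g.Site, ∑ c : IBondY i, Real.exp (-(ρR * g.dist y (σI c))) ≤ cR) :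
    HasMajorant (g := toB6 g R₀ H₀) (fun p : XBK (TrIdx N) i => σ p.1)
      (r • coordOpK (trBasis N) (fun _ : Fin (d + 1) => (delta2OfHY (trDualMatY N) i H C U).restrictScalars ℝ))
      (fun (y y' : g.Site) => r * (2 * N * basisBound39 (trBasis N) ^ 2 * κC * tHJ * CT * cR) * W y * Real.exp (-(δ₂ * g.dist y y'))) := by
  intro y' μ Bd hμ p
  obtain ⟨z, ν, k, k'⟩ := p
  rw [LinearMap.smul_apply, Pi.smul_apply, coordOpK_apply, smul_eq_mul, abs_mul, abs_of_nonneg hr]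
  simp only [LinearMap.restrictScalars_apply]
  -- the assembled slice: supported in the block of `y′`, bounded by `b·Bd`
  set A : FBondY i → Matrix (Fin N) (Fin N) ℂ := assembleK (trBasis N) ν k' μ with hA
  set bB : ℝ := basisBound39 (trBasis N) with hbB
  have hbB0 : 0 ≤ bB := Finset.sum_nonneg fun c _ => norm_nonneg _
  have hAoff : ∀ w, σ w ≠ y' → A w = 0 := fun w hw => assembleK_eq_zero_of (trBasis N) ν k' μ w fun a => hμ.off (w, ν, a, k') hw
  have hAbd : ∀ w, σ w = y' → ‖A w‖ ≤ bB * Bd := fun w hw => norm_assembleK_le (trBasis N) ν k' μ w fun a => hμ.bound (w, ν, a, k') hw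
  -- the two letters at this slice
  set KC : IBondY i → ℝ := fun c =>
    κC * wC (σI c) * Real.exp (-(δC * g.dist (σI c) (σ z))) * Real.exp (-(δC * g.dist (σI c) y')) * (bB * Bd) with hKC
  have hKC0 : ∀ c, 0 ≤ KC c := fun c =>
    mul_nonneg (mul_nonneg (mul_nonneg (mul_nonneg hκC (hwC _)) (Real.exp_nonneg _)) (Real.exp_nonneg _)) (mul_nonneg hbB0 hμ.nonneg)
  have hCz : ∀ (a : Matrix (Fin N) (Fin N) ℂ) (c : IBondY i), ‖C U A (deltaY z a) c‖ ≤ KC c * ‖a‖ := fun a c =>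
    hC2 y' A (bB * Bd) (mul_nonneg hbB0 hμ.nonneg) hAbd hAoff z a c
  have hrepr := abs_repr_delta2OfHY_apply_le i H C U A z hKC0 hCz (fun c => hHJ c) k
  -- ‖E_k‖ ≤ b
  have hbk : ‖trBasis N k‖ ≤ bB := by
    rw [hbB, basisBound39]
    exact Finset.single_le_sum (f := fun c => ‖trBasis N c‖) (fun c _ => norm_nonneg _) (Finset.mem_univ k)
  -- the sum over the coarse bonds
  have hsum : ∑ c, KC c * (tHJ * wH (σI c)) ≤ κC * bB * Bd * tHJ * CT * cR * W (σ z) * Real.exp (-(δ₂ * g.dist (σ z) y')) := by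
    have hterm : ∀ c, KC c * (tHJ * wH (σI c)) ≤
        κC * bB * Bd * tHJ * (CT * W (σ z)) * Real.exp (-(δ₂ * g.dist (σ z) y')) * Real.exp (-(ρR * g.dist (σ z) (σI c))) := by
      intro c
      have h3 := exp_three_point_le hG hδ₂ hρT hρR hδC (σ z) y' (σI c)
      have hww : 0 ≤ wC (σI c) * wH (σI c) := mul_nonneg (hwC _) (hwH _)
      have hT' := hT (σ z) c
      have hpre : 0 ≤ κC * bB * Bd * tHJ := mul_nonneg (mul_nonneg (mul_nonneg hκC hbB0) hμ.nonneg) htHJ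
      calc KC c * (tHJ * wH (σI c))
          = κC * bB * Bd * tHJ * (wC (σI c) * wH (σI c)) *
              (Real.exp (-(δC * g.dist (σI c) (σ z))) * Real.exp (-(δC * g.dist (σI c) y'))) := by rw [hKC]; ring
        _ ≤ κC * bB * Bd * tHJ * (wC (σI c) * wH (σI c)) *
              (Real.exp (-(δ₂ * g.dist (σ z) y')) * Real.exp (-(ρT * g.dist (σ z) (σI c))) * Real.exp (-(ρR * g.dist (σ z) (σI c)))) :=
            mul_le_mul_of_nonneg_left h3 (mul_nonneg hpre hww)
        _ = κC * bB * Bd * tHJ * (Real.exp (-(ρT * g.dist (σ z) (σI c))) * (wC (σI c) * wH (σI c))) *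
              Real.exp (-(δ₂ * g.dist (σ z) y')) * Real.exp (-(ρR * g.dist (σ z) (σI c))) := by ring
        _ ≤ κC * bB * Bd * tHJ * (CT * W (σ z)) * Real.exp (-(δ₂ * g.dist (σ z) y')) * Real.exp (-(ρR * g.dist (σ z) (σI c))) :=
            mul_le_mul_of_nonneg_right (mul_le_mul_of_nonneg_right (mul_le_mul_of_nonneg_left hT' hpre) (Real.exp_nonneg _))
              (Real.exp_nonneg _)
    have hCW : 0 ≤ CT * W (σ z) := mul_nonneg hCT (hW _)
    calc ∑ c, KC c * (tHJ * wH (σI c))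
        ≤ ∑ c, κC * bB * Bd * tHJ * (CT * W (σ z)) * Real.exp (-(δ₂ * g.dist (σ z) y')) * Real.exp (-(ρR * g.dist (σ z) (σI c))) :=
          Finset.sum_le_sum fun c _ => hterm c
      _ = κC * bB * Bd * tHJ * (CT * W (σ z)) * Real.exp (-(δ₂ * g.dist (σ z) y')) * ∑ c, Real.exp (-(ρR * g.dist (σ z) (σI c))) := by
          rw [Finset.mul_sum]
      _ ≤ κC * bB * Bd * tHJ * (CT * W (σ z)) * Real.exp (-(δ₂ * g.dist (σ z) y')) * cR :=
          mul_le_mul_of_nonneg_left (hR (σ z))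
            (mul_nonneg (mul_nonneg (mul_nonneg (mul_nonneg (mul_nonneg hκC hbB0) hμ.nonneg) htHJ) hCW) (Real.exp_nonneg _))
      _ = κC * bB * Bd * tHJ * CT * cR * W (σ z) * Real.exp (-(δ₂ * g.dist (σ z) y')) := by ring
  have hN : (0 : ℝ) ≤ N := Nat.cast_nonneg N
  calc r * |(trBasis N).repr (delta2OfHY (trDualMatY N) i H C U A z) k|
      ≤ r * (2 * N * ‖trBasis N k‖ * ∑ c, KC c * (tHJ * wH (σI c))) := mul_le_mul_of_nonneg_left hrepr hr
    _ ≤ r * (2 * N * bB * (κC * bB * Bd * tHJ * CT * cR * W (σ z) * Real.exp (-(δ₂ * g.dist (σ z) y')))) := by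
        refine mul_le_mul_of_nonneg_left ?_ hr
        exact mul_le_mul (mul_le_mul_of_nonneg_left hbk (mul_nonneg two_pos.le hN)) hsum
          (Finset.sum_nonneg fun c _ => mul_nonneg (hKC0 c) (mul_nonneg htHJ (hwH _))) (mul_nonneg (mul_nonneg two_pos.le hN) hbB0)
    _ = r * (2 * N * basisBound39 (trBasis N) ^ 2 * κC * tHJ * CT * cR) * W (σ z) * Real.exp (-(δ₂ * g.dist (σ z) y')) * Bd := by
        rw [hbB]; ring

end Majorant

end Literature.MathematicalPhysics.QuantumFieldTheory.Balaban1983to89.B9Delta2FormMajorantH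

end
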